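import Mathlib
import Summits.AtomisticToContinuum.FouriersLaw.Theses.EmbeddedDrudeMourre
import HarnessLib

/-!
# The `η⁻²` sup bound in the corner regime: the algebra
(crux `EmbeddedDrudeMourre.DrudeDissolution`, item stmt-AtomisticToContinuum-12593; `--supports` file for the
registered sub-goal `supBound_corner_algebra` of stub B1b″ `stub_excursionSecondDifference` of line
`kinetic-polymer-gas-on-the-time-axis`; closes nothing; lead c13 (process B), 2026-08-17)

WHAT. Companion of `supBound_curve_algebra` for the CORNER REGIME of the sup-norm route. Near a corner the
local data of `flux_pointwise_bound` are, with `d` the corner distance (`η² ≤ d`), floor `m = √(cd)`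
(`0 < c ≤ 1`), `g₀ = C d`, `g₁ = C(√d + d·a/η)`, `g₂ = C(1 + 2√d·a/η + d·b/η²)`, `n = Cₙ`, `t = Cₜ`. Then
`B = 9g₂/m² + 189g₁n/m³ + 63g₀t/m³ + 1359g₀n²/m⁴ ≤ K/η²` with
`K = 9C(1+2a+b)/c + 189·C·Cₙ(1+a)/(c√c) + 63·C·Cₜ/(c√c) + 1359·C·Cₙ²/c²` (`supBound_corner_algebra`).

WHY (role). The corner half of item (C6) (per-point sup bound) of the remaining concrete work for B1b″.
-/

noncomputable section

namespace Summit.AtomisticToContinuum.FouriersLaw.Theorems.DrudeDissolution.KineticPolymerGasOnTheTimeAxis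

/-- **The corner-regime algebra (registered sub-goal `supBound_corner_algebra` of stub B1b″).** See the module
docstring. [folklore] -/
theorem supBound_corner_algebra :
    ∀ (d η c C a b Cn Ct : ℝ), 0 < η → η ≤ 1 → η ^ 2 ≤ d → 0 < c → c ≤ 1 →
      0 ≤ C → 0 ≤ a → 0 ≤ b → 0 ≤ Cn → 0 ≤ Ct →
      9 * (C * (1 + 2 * Real.sqrt d * a / η + d * b / η ^ 2)) / Real.sqrt (c * d) ^ 2 +
          189 * (C * (Real.sqrt d + d * a / η)) * Cn / Real.sqrt (c * d) ^ 3 +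
          63 * (C * d) * Ct / Real.sqrt (c * d) ^ 3 + 1359 * (C * d) * Cn ^ 2 / Real.sqrt (c * d) ^ 4 ≤
        (9 * C * (1 + 2 * a + b) / c + 189 * C * Cn * (1 + a) / (c * Real.sqrt c) + 63 * C * Ct / (c * Real.sqrt c) +
          1359 * C * Cn ^ 2 / c ^ 2) / η ^ 2 := by
  intro d η c C a b Cn Ct hη hη1 hηd hc hc1 hC ha hb hCn hCt
  have hη2 : 0 < η ^ 2 := pow_pos hη 2
  have hd : 0 < d := lt_of_lt_of_le hη2 hηd
  set s := Real.sqrt d with hs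
  have hs0 : 0 < s := Real.sqrt_pos.2 hd
  have hs2 : s ^ 2 = d := Real.sq_sqrt hd.le
  set r := Real.sqrt c with hr
  have hr0 : 0 < r := Real.sqrt_pos.2 hc
  have hr2 : r ^ 2 = c := Real.sq_sqrt hc.le
  have hsq : Real.sqrt (c * d) = r * s := by rw [hr, hs, Real.sqrt_mul hc.le]
  have hm2 : Real.sqrt (c * d) ^ 2 = c * d := Real.sq_sqrt (by positivity)
  have hm3 : Real.sqrt (c * d) ^ 3 = c * r * (d * s) := by
    rw [hsq, ← hr2, ← hs2]; ring
  have hm4 : Real.sqrt (c * d) ^ 4 = c ^ 2 * d ^ 2 := by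
    rw [show (4 : ℕ) = 2 * 2 by norm_num, pow_mul, hm2]; ring
  rw [hm2, hm3, hm4]
  -- `η ≤ s`, so `1/d ≤ 1/η²`, `1/(η s) ≤ 1/η²`, `1/s ≤ 1/η ≤ 1/η²`
  have hηs : η ≤ s := by
    rw [hs, ← Real.sqrt_sq hη.le]; exact Real.sqrt_le_sqrt hηd
  have j1 : 1 / d ≤ 1 / η ^ 2 := one_div_le_one_div_of_le hη2 hηd
  have j2 : 1 / (η * s) ≤ 1 / η ^ 2 := by
    rw [pow_two]; exact one_div_le_one_div_of_le (mul_pos hη hη) (mul_le_mul_of_nonneg_left hηs hη.le)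
  have j3 : 1 / s ≤ 1 / η ^ 2 := by
    have h1 : 1 / s ≤ 1 / η := one_div_le_one_div_of_le hη hηs
    have h2 : 1 / η ≤ 1 / η ^ 2 := by
      rw [pow_two]; exact one_div_le_one_div_of_le (mul_pos hη hη) (by nlinarith)
    exact h1.trans h2
  -- T1
  have T1 : 9 * (C * (1 + 2 * s * a / η + d * b / η ^ 2)) / (c * d) ≤ 9 * C * (1 + 2 * a + b) / c / η ^ 2 := by
    have e : 9 * (C * (1 + 2 * s * a / η + d * b / η ^ 2)) / (c * d) =
        9 * C / c * (1 / d + 2 * a * (s / (η * d)) + b * (1 / η ^ 2)) := by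
      field_simp
    have hsd : s / (η * d) = 1 / (η * s) := by
      rw [div_eq_div_iff (by positivity) (by positivity), ← hs2]; ring
    rw [e, hsd]
    calc 9 * C / c * (1 / d + 2 * a * (1 / (η * s)) + b * (1 / η ^ 2))
        ≤ 9 * C / c * (1 / η ^ 2 + 2 * a * (1 / η ^ 2) + b * (1 / η ^ 2)) := by gcongr
      _ = 9 * C * (1 + 2 * a + b) / c / η ^ 2 := by field_simp
  -- T2
  have T2 : 189 * (C * (s + d * a / η)) * Cn / (c * r * (d * s)) ≤ 189 * C * Cn * (1 + a) / (c * r) / η ^ 2 := by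
    have e : 189 * (C * (s + d * a / η)) * Cn / (c * r * (d * s)) =
        189 * C * Cn / (c * r) * (s / (d * s) + a * (d / (η * (d * s)))) := by
      field_simp
    have e1 : s / (d * s) = 1 / d := by rw [div_eq_div_iff (by positivity) (by positivity)]; ring
    have e2 : d / (η * (d * s)) = 1 / (η * s) := by rw [div_eq_div_iff (by positivity) (by positivity)]; ring
    rw [e, e1, e2]
    calc 189 * C * Cn / (c * r) * (1 / d + a * (1 / (η * s)))
        ≤ 189 * C * Cn / (c * r) * (1 / η ^ 2 + a * (1 / η ^ 2)) := by gcongr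
      _ = 189 * C * Cn * (1 + a) / (c * r) / η ^ 2 := by field_simp
  -- T3
  have T3 : 63 * (C * d) * Ct / (c * r * (d * s)) ≤ 63 * C * Ct / (c * r) / η ^ 2 := by
    have e : 63 * (C * d) * Ct / (c * r * (d * s)) = 63 * C * Ct / (c * r) * (1 / s) := by
      field_simp
    rw [e]
    calc 63 * C * Ct / (c * r) * (1 / s) ≤ 63 * C * Ct / (c * r) * (1 / η ^ 2) := by gcongr
      _ = 63 * C * Ct / (c * r) / η ^ 2 := by field_simp
  -- T4
  have T4 : 1359 * (C * d) * Cn ^ 2 / (c ^ 2 * d ^ 2) ≤ 1359 * C * Cn ^ 2 / c ^ 2 / η ^ 2 := by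
    have e : 1359 * (C * d) * Cn ^ 2 / (c ^ 2 * d ^ 2) = 1359 * C * Cn ^ 2 / c ^ 2 * (1 / d) := by
      field_simp
    rw [e]
    calc 1359 * C * Cn ^ 2 / c ^ 2 * (1 / d) ≤ 1359 * C * Cn ^ 2 / c ^ 2 * (1 / η ^ 2) := by gcongr
      _ = 1359 * C * Cn ^ 2 / c ^ 2 / η ^ 2 := by field_simp
  have hs' : Real.sqrt d = s := rfl
  rw [hs'] at *
  have htot := add_le_add (add_le_add (add_le_add T1 T2) T3) T4
  refine htot.trans (le_of_eq ?_)
  rw [hr]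
  field_simp

end Summit.AtomisticToContinuum.FouriersLaw.Theorems.DrudeDissolution.KineticPolymerGasOnTheTimeAxis

end
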